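import Summits.QuantumFields.GaugeBoot.LoopEquationFunctional
import Summits.QuantumFields.GaugeBoot.EquipartitionSOS
import HarnessLib

/-!
# Gauge-boot: THE EQUIPARTITION BOUND IS A LEVEL-4 BOOTSTRAP CONSEQUENCE — every functional with the plaquette
# loop-equation rows and positivity on squares of level-4 words obeys `Σ_{P∋e} φ(u_P) ≤ 2(d−1)(1 − c/(4(d−1)β + c))`
# (large-`N` supplement 18, part 5c)

HONEST FRAMING (cell `pub-gaugeboot`, page 1 of every file): certified bounds on lattice
expectations at STATED coupling, gauge group, dimension and torus size; NOT a mass gap, NOT a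
continuum limit, NOT a string tension, NOT large `N`; NOT Yang–Mills-summit-bearing (barriers
`FixedCouplingUltralocality`, `PerturbativeInvisibility`).  A statement about what EVERY feasible point of a
truncated bootstrap SDP satisfies — an a-priori ceiling on SDP upper bounds; it certifies no number of CERTIFIED.md.

## Content

Parts 4a–b derived `⟨ū_P⟩ ≤ 1 − c/(4(d−1)β + c)` for Wilson's MEASURE from (i) the loop equation summed over the
plaquette words through an edge, (ii) the inequality `‖M − Mᴴ‖²/2 ≤ 8(d−1)·Σ cost`, (iii) orbit averaging.  Here (i) is
the functional-level loop equation of part 5a and (ii) the explicit SOS certificate of part 5b, so the argument runs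
for every LINEAR FUNCTIONAL `φ` on `C(GaugeConfig, ℝ)` with `φ 1 = 1`, `0 ≤ φ(v²)` for the level-`n` test functions of
the lane's word truncation (`n ≥ 4`), and the pair rows for the `2(d−1)` plaquette words through `(x, μ)` at weight
`s` — the constraints of the lane's level-`n` word SDP restricted to the plaquette rows:
* `evalR_norm_sq_nonneg` — `0 ≤ φ(‖W‖²_F)` for every matrix observable with level-`n` word entries;
* ★★ `rows_re_identity` — `c·Σφ(Re tr V) + (β/2)(−½ φ‖M − Mᴴ‖² + (2s/N) φ(Im tr M)²) = 0`;
  ★★ `evalR_norm_sq_A_le` — `φ(‖M − Mᴴ‖²) ≤ 16(d−1)·Σ φ(N − Re tr V)` (the SOS certificate under `φ`);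
* ★★★ `sum_evalR_plaquette_le_of_sdPairF` — for `d ≥ 2`, `L ≥ 2`, `β ≥ 0`, `0 ≤ s < N²`, `c = N − s/N`:
  **`Σ_{ν≠μ, ε} φ((1/N) Re tr ρ(hol P̃_{ν,ε})) ≤ 2(d−1)·(1 − c/(4(d−1)β + c))`** — the AVERAGE over the `2(d−1)`
  plaquettes through any edge obeys the equipartition bound (orbit averaging is not available for a general `φ`;
  for the lane's symmetry-reduced SDPs all these values are `φ(ū_P)`).  So a word SDP of level `≥ 4` containing the
  plaquette `(MM)` rows can never certify an upper bound above `1 − c/(4(d−1)β + c)` for the edge-averaged plaquette.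
[folklore]
-/

noncomputable section

open Filter Topology NormedSpace
open scoped Matrix.Norms.Frobenius Matrix
open Literature.MathematicalPhysics.QuantumFieldTheory
open Summit.QuantumFields.YangMills.Cruxes.CurvatureAmnesia.WardDefect.SchwingerDyson

namespace Summit.QuantumFields.GaugeBoot

namespace Equipartition

variable {d L : ℕ} {G : Type} [Group G] [TopologicalSpace G] [IsTopologicalGroup G] (r : LatticeRep G)
  (φ : C(GaugeConfig d L G, ℝ) →ₗ[ℝ] ℝ)

/-! ## Positivity of `φ` on squared Hilbert–Schmidt norms of word matrices -/

omit [Group G] [IsTopologicalGroup G] in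
/-- Double finite sums under `Φ`. [folklore] -/
theorem evalC_sum₂ {ι κ : Type*} (s : Finset ι) (t : Finset κ) (F : ι → κ → GaugeConfig d L G → ℂ)
    (hF : ∀ i k, Continuous (F i k)) :
    evalC φ (fun U => ∑ i ∈ s, ∑ k ∈ t, F i k U) = ∑ i ∈ s, ∑ k ∈ t, evalC φ (F i k) := by
  rw [evalC_sum φ s _ fun i => continuous_finsetSum t fun k _ => hF i k]
  exact Finset.sum_congr rfl fun i _ => evalC_sum φ t _ fun k => hF i k

omit [Group G] [IsTopologicalGroup G] in
/-- Double finite sums under `evalR`. [folklore] -/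
theorem evalR_sum₂ {ι κ : Type*} (s : Finset ι) (t : Finset κ) (f : ι → κ → GaugeConfig d L G → ℝ)
    (hf : ∀ i k, Continuous (f i k)) :
    evalR φ (fun U => ∑ i ∈ s, ∑ k ∈ t, f i k U) = ∑ i ∈ s, ∑ k ∈ t, evalR φ (f i k) := by
  rw [evalR_sum φ s _ fun i => continuous_finsetSum t fun k _ => hf i k]
  exact Finset.sum_congr rfl fun i _ => evalR_sum φ t _ fun k => hf i k

omit [IsTopologicalGroup G] in
/-- ★ **`0 ≤ φ(‖W‖²_F)` for a matrix observable with level-`n` word entries**, when `φ` is non-negative on the squares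
of level-`n` test functions: `‖W‖² = Σ_{ab} (Re W_ab)² + (Im W_ab)²`. [folklore] -/
theorem evalR_norm_sq_nonneg {n : ℕ} (hpos : ∀ v ∈ wordTruncation (ι := Edge d L) r n, 0 ≤ φ (v * v))
    {W : GaugeConfig d L G → Matrix (Fin r.N) (Fin r.N) ℂ} (hW : EntriesIn r (Set.univ : Set (Edge d L)) n W) :
    0 ≤ evalR φ (fun U => ‖W U‖ ^ 2) := by
  -- each entry's real and imaginary part is a level-`n` test function
  have hsq : ∀ a b, ∃ gre gim : C(GaugeConfig d L G, ℝ), gre ∈ wordTruncation (ι := Edge d L) r n ∧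
      gim ∈ wordTruncation (ι := Edge d L) r n ∧ (∀ U, gre U = (W U a b).re) ∧ ∀ U, gim U = (W U a b).im := by
    intro a b
    obtain ⟨gre, hgre, hgre'⟩ := (mem_wordFunctions_iff r).1 (hW a b).1
    obtain ⟨gim, hgim, hgim'⟩ := (mem_wordFunctions_iff r).1 (hW a b).2
    exact ⟨gre, gim, mem_wordTruncation_of_mem_wordSpace r hgre, mem_wordTruncation_of_mem_wordSpace r hgim,
      fun U => congrFun hgre' U, fun U => congrFun hgim' U⟩
  choose gre gim hgre hgim hre him using hsq
  have hentry : ∀ a b, (fun U => ‖W U a b‖ ^ 2) = ⇑(gre a b * gre a b + gim a b * gim a b) := by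
    intro a b
    funext U
    simp only [ContinuousMap.add_apply, ContinuousMap.mul_apply, hre, him, Complex.sq_norm, Complex.normSq_apply]
  have hcont : ∀ a b, Continuous fun U => ‖W U a b‖ ^ 2 := fun a b => by
    rw [hentry a b]; exact ContinuousMap.continuous _
  have hexp : (fun U => ‖W U‖ ^ 2) = fun U => ∑ a, ∑ b, ‖W U a b‖ ^ 2 := by
    funext U; exact UnitaryCayley.frobenius_norm_sq (W U)
  rw [hexp, evalR_sum₂ φ _ _ _ hcont]
  refine Finset.sum_nonneg fun a _ => Finset.sum_nonneg fun b _ => ?_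
  rw [hentry a b, evalR_coe, map_add]
  exact add_nonneg (hpos _ (hgre a b)) (hpos _ (hgim a b))

omit [IsTopologicalGroup G] in
/-- `0 ≤ φ(v²)` for a single level-`n` test function given unbundled. [folklore] -/
theorem evalR_sq_nonneg {n : ℕ} (hpos : ∀ v ∈ wordTruncation (ι := Edge d L) r n, 0 ≤ φ (v * v))
    {v : C(GaugeConfig d L G, ℝ)} (hv : v ∈ wordTruncation (ι := Edge d L) r n) :
    0 ≤ evalR φ (fun U => v U ^ 2) := by
  have h : (fun U => v U ^ 2) = ⇑(v * v) := by funext U; simp [sq]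
  rw [h, evalR_coe]
  exact hpos v hv

/-! ## The summed plaquette rows of a functional, real part -/

section Rows

variable [NeZero L]

/-- ★★ **The plaquette–gradient identity for a functional.**  If `φ` has the pair rows for the `2(d−1)` plaquette
words through `(x, μ)` at the real weight `s` (`L ≥ 2`), then with `R = Σ φ(Re tr V_{ν,ε})`, `M = plaqSum`:
`c·R + (β/2)·(−½ φ(‖M − Mᴴ‖²) + (2s/N) φ((Im tr M)²)) = 0`, `c = N − s/N`. [folklore] -/
theorem rows_re_identity (hL : (1 : ZMod L) ≠ 0) (β : ℝ) (x : Site d L) (μ : Fin d) (s : ℝ)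
    (hP : ∀ ν ∈ Finset.univ.erase μ, ∀ (ε : Bool) (i j : Fin r.N),
      SDPairF r φ β x μ x (plaqWord μ ν ε) (unitDir (s : ℂ) i j)) :
    ((r.N : ℝ) - s / r.N) * (∑ ν ∈ Finset.univ.erase μ, ∑ ε : Bool,
        evalR φ (fun U => (r.ρ (wordHolonomy U x (plaqWord μ ν ε))).trace.re)) +
      β / 2 * (-(1 / 2) * evalR φ (fun U => ‖plaqSum r.ρ x μ U - star (plaqSum r.ρ x μ U)‖ ^ 2) +
        2 * s / r.N * evalR φ (fun U => ((plaqSum r.ρ x μ U).trace.im) ^ 2)) = 0 := by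
  have hcC : ((r.N : ℂ) - (s : ℂ) / r.N) = (((r.N : ℝ) - s / r.N : ℝ) : ℂ) := by push_cast; ring
  have hcV : ∀ ν ε, Continuous fun U : GaugeConfig d L G => r.ρ (wordHolonomy U x (plaqWord μ ν ε)) :=
    fun ν ε => r.continuous.comp (continuous_wordHolonomy x _)
  have hcT : ∀ ν ε, Continuous fun U : GaugeConfig d L G => (r.ρ (wordHolonomy U x (plaqWord μ ν ε))).trace :=
    fun ν ε => (hcV ν ε).matrix_trace
  have hM : Continuous fun U : GaugeConfig d L G => plaqSum r.ρ x μ U := by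
    unfold plaqSum
    exact continuous_finsetSum _ fun ν _ => continuous_finsetSum _ fun ε _ => hcV ν ε
  have hTr : Continuous fun U : GaugeConfig d L G => (plaqSum r.ρ x μ U).trace := hM.matrix_trace
  -- Step 1: the loop equation of each plaquette word, split terms evaluated
  have hrow : ∀ ν ∈ Finset.univ.erase μ, ∀ ε : Bool,
      (((r.N : ℝ) - s / r.N : ℝ) : ℂ) * evalC φ (fun U => (r.ρ (wordHolonomy U x (plaqWord μ ν ε))).trace) +
        (β / 2 : ℂ) * ∑ ν' ∈ Finset.univ.erase μ, ∑ ε' : Bool,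
          evalC φ (fun U => plaqTerm r.ρ (s : ℂ) x μ U (plaqWord μ ν ε) ν' ε') = 0 := by
    intro ν hν ε
    have hμν : μ ≠ ν := (Finset.ne_of_mem_erase hν).symm
    have h := loopEquationF_of_sdPairF r φ β x μ (s : ℂ) (plaqWord μ ν ε) (endpoint_plaqWord x μ ν ε) (hP ν hν ε)
    have hsplit : ∑ k ∈ Finset.range (plaqWord μ ν ε).length,
        evalC φ (fun U => splitTerm r.ρ (s : ℂ) x μ U (plaqWord μ ν ε) k) =
        (((r.N : ℝ) - s / r.N : ℝ) : ℂ) * evalC φ (fun U => (r.ρ (wordHolonomy U x (plaqWord μ ν ε))).trace) := by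
      rw [← evalC_sum φ _ _ fun k => continuous_splitTerm r (s : ℂ) x μ _ k,
        evalC_congr φ fun U => sum_splitTerm_plaqWord r.ρ hL (s : ℂ) x hμν U ε, hcC,
        evalC_smul φ _ (hcT ν ε)]
    rwa [hsplit] at h
  -- Step 2: sum over the plaquette words
  have hsum : (((r.N : ℝ) - s / r.N : ℝ) : ℂ) * ∑ ν ∈ Finset.univ.erase μ, ∑ ε : Bool,
        evalC φ (fun U => (r.ρ (wordHolonomy U x (plaqWord μ ν ε))).trace) +
      (β / 2 : ℂ) * ∑ ν ∈ Finset.univ.erase μ, ∑ ε : Bool, ∑ ν' ∈ Finset.univ.erase μ, ∑ ε' : Bool,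
        evalC φ (fun U => plaqTerm r.ρ (s : ℂ) x μ U (plaqWord μ ν ε) ν' ε') = 0 := by
    have h := Finset.sum_eq_zero (s := Finset.univ.erase μ) fun ν hν =>
      Finset.sum_eq_zero (s := (Finset.univ : Finset Bool)) fun ε _ => hrow ν hν ε
    rw [← h, Finset.mul_sum, Finset.mul_sum, ← Finset.sum_add_distrib]
    refine Finset.sum_congr rfl fun ν _ => ?_
    rw [Finset.mul_sum, Finset.mul_sum, ← Finset.sum_add_distrib]
  -- Step 3: the quadruple sum is `Φ` of the closed form
  have hQ : ∑ ν ∈ Finset.univ.erase μ, ∑ ε : Bool, ∑ ν' ∈ Finset.univ.erase μ, ∑ ε' : Bool,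
        evalC φ (fun U => plaqTerm r.ρ (s : ℂ) x μ U (plaqWord μ ν ε) ν' ε') =
      evalC φ (fun U => (plaqSum r.ρ x μ U * plaqSum r.ρ x μ U).trace -
        (plaqSum r.ρ x μ U * star (plaqSum r.ρ x μ U)).trace -
        ((s : ℂ) / r.N) * ((plaqSum r.ρ x μ U).trace * ((plaqSum r.ρ x μ U).trace - star (plaqSum r.ρ x μ U).trace))) := by
    rw [← evalC_congr φ fun U => sum_sum_plaqTerm_eq r.mem_unitary (s : ℂ) x μ U,
      evalC_sum₂ φ _ _ _ fun ν ε => continuous_finsetSum _ fun ν' _ => continuous_finsetSum _ fun ε' _ =>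
        continuous_plaqTerm r (s : ℂ) x μ _ ν' ε']
    exact Finset.sum_congr rfl fun ν _ => Finset.sum_congr rfl fun ε _ =>
      (evalC_sum₂ φ _ _ _ fun ν' ε' => continuous_plaqTerm r (s : ℂ) x μ _ ν' ε').symm
  -- Step 4: real parts
  have hI₁ : (∑ ν ∈ Finset.univ.erase μ, ∑ ε : Bool,
      evalC φ (fun U => (r.ρ (wordHolonomy U x (plaqWord μ ν ε))).trace)).re =
      ∑ ν ∈ Finset.univ.erase μ, ∑ ε : Bool, evalR φ (fun U => (r.ρ (wordHolonomy U x (plaqWord μ ν ε))).trace.re) := by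
    rw [Complex.re_sum]
    simp_rw [Complex.re_sum, evalC_re]
  have hA : Continuous fun U : GaugeConfig d L G => ‖plaqSum r.ρ x μ U - star (plaqSum r.ρ x μ U)‖ ^ 2 :=
    ((hM.sub hM.star).norm).pow 2
  have hImT : Continuous fun U : GaugeConfig d L G => ((plaqSum r.ρ x μ U).trace.im) ^ 2 :=
    (Complex.continuous_im.comp hTr).pow 2
  have hI₂ : (evalC φ (fun U => (plaqSum r.ρ x μ U * plaqSum r.ρ x μ U).trace -
        (plaqSum r.ρ x μ U * star (plaqSum r.ρ x μ U)).trace -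
        ((s : ℂ) / r.N) * ((plaqSum r.ρ x μ U).trace * ((plaqSum r.ρ x μ U).trace - star (plaqSum r.ρ x μ U).trace)))).re =
      -(1 / 2) * evalR φ (fun U => ‖plaqSum r.ρ x μ U - star (plaqSum r.ρ x μ U)‖ ^ 2) +
        2 * s / r.N * evalR φ (fun U => ((plaqSum r.ρ x μ U).trace.im) ^ 2) := by
    rw [evalC_re]
    have hpt : (fun U => ((plaqSum r.ρ x μ U * plaqSum r.ρ x μ U).trace -
        (plaqSum r.ρ x μ U * star (plaqSum r.ρ x μ U)).trace -
        ((s : ℂ) / r.N) * ((plaqSum r.ρ x μ U).trace * ((plaqSum r.ρ x μ U).trace - star (plaqSum r.ρ x μ U).trace))).re) =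
        fun U => -(1 / 2) * ‖plaqSum r.ρ x μ U - star (plaqSum r.ρ x μ U)‖ ^ 2 +
          2 * s / r.N * ((plaqSum r.ρ x μ U).trace.im) ^ 2 := by
      funext U; rw [re_quadratic_eq]; ring
    have hc1 : Continuous fun U : GaugeConfig d L G => -(1 / 2) * ‖plaqSum r.ρ x μ U - star (plaqSum r.ρ x μ U)‖ ^ 2 :=
      continuous_const.mul hA
    have hc2 : Continuous fun U : GaugeConfig d L G => 2 * s / r.N * ((plaqSum r.ρ x μ U).trace.im) ^ 2 :=
      continuous_const.mul hImT
    rw [hpt, evalR_add φ hc1 hc2, evalR_smul φ _ hA, evalR_smul φ _ hImT]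
  have hre := congrArg Complex.re hsum
  rw [Complex.add_re, Complex.re_ofReal_mul, hI₁, hQ, show (β / 2 : ℂ) = ((β / 2 : ℝ) : ℂ) by push_cast; ring,
    Complex.re_ofReal_mul, hI₂, Complex.zero_re] at hre
  exact hre

omit [IsTopologicalGroup G] [NeZero L] in
/-- `0 ≤ φ((Im tr M)²)` (`Im tr M` is a sum of level-4 test functions). [folklore] -/
theorem evalR_imTrace_plaqSum_sq_nonneg (x : Site d L) (μ : Fin d) {n : ℕ} (hn : 4 ≤ n)
    (hpos : ∀ v ∈ wordTruncation (ι := Edge d L) r n, 0 ≤ φ (v * v)) :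
    0 ≤ evalR φ (fun U => ((plaqSum r.ρ x μ U).trace.im) ^ 2) := by
  set v : C(GaugeConfig d L G, ℝ) := ∑ ν ∈ Finset.univ.erase μ, ∑ ε : Bool, imTrWordCM r x (plaqWord μ ν ε) with hv
  have hvmem : v ∈ wordTruncation (ι := Edge d L) r n := by
    rw [hv]
    refine Submodule.sum_mem _ fun ν _ => Submodule.sum_mem _ fun ε _ => ?_
    exact imTrWordCM_mem_wordTruncation r x _ ((length_plaqWord μ ν ε).trans_le hn)
  have hfun : (fun U => ((plaqSum r.ρ x μ U).trace.im) ^ 2) = fun U => v U ^ 2 := by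
    funext U
    simp only [hv, plaqSum, Matrix.trace_sum, Complex.im_sum, ContinuousMap.coe_sum, Finset.sum_apply, imTrWordCM_apply]
  rw [hfun]
  exact evalR_sq_nonneg r φ hpos hvmem

omit [NeZero L] in
/-- ★★ **`φ(‖M − Mᴴ‖²) ≤ 16(d−1)·Σ_p φ(N − Re tr V_p)`** — `φ` applied to the SOS certificate of part 5b. [folklore] -/
theorem evalR_norm_sq_A_le (hd : 2 ≤ d) (x : Site d L) (μ : Fin d) {n : ℕ} (hn : 4 ≤ n)
    (hpos : ∀ v ∈ wordTruncation (ι := Edge d L) r n, 0 ≤ φ (v * v)) :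
    evalR φ (fun U => ‖plaqSum r.ρ x μ U - star (plaqSum r.ρ x μ U)‖ ^ 2) ≤
      16 * ((d : ℝ) - 1) * ∑ p ∈ (Finset.univ.erase μ) ×ˢ (Finset.univ : Finset Bool),
        evalR φ (fun U => (r.N : ℝ) - (r.ρ (wordHolonomy U x (plaqWord μ p.1 p.2))).trace.re) := by
  have hcV : ∀ ν ε, Continuous fun U : GaugeConfig d L G => r.ρ (wordHolonomy U x (plaqWord μ ν ε)) :=
    fun ν ε => r.continuous.comp (continuous_wordHolonomy x _)
  have hcRe : ∀ ν ε, Continuous fun U : GaugeConfig d L G => (r.ρ (wordHolonomy U x (plaqWord μ ν ε))).trace.re :=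
    fun ν ε => Complex.continuous_re.comp (hcV ν ε).matrix_trace
  have hM : Continuous fun U : GaugeConfig d L G => plaqSum r.ρ x μ U := by
    unfold plaqSum
    exact continuous_finsetSum _ fun ν _ => continuous_finsetSum _ fun ε _ => hcV ν ε
  have hW₁ : ∀ p : Fin d × Bool, EntriesIn r (Set.univ : Set (Edge d L)) n (fun U : GaugeConfig d L G =>
      ((1 : Matrix (Fin r.N) (Fin r.N) ℂ) - r.ρ (wordHolonomy U x (plaqWord μ p.1 p.2))) +
        ((1 : Matrix (Fin r.N) (Fin r.N) ℂ) - r.ρ (wordHolonomy U x (plaqWord μ p.1 p.2)))ᴴ) := by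
    intro p
    have h4 : EntriesIn r (Set.univ : Set (Edge d L)) 4 (fun U : GaugeConfig d L G =>
        (1 : Matrix (Fin r.N) (Fin r.N) ℂ) - r.ρ (wordHolonomy U x (plaqWord μ p.1 p.2))) :=
      (entriesIn_const r _ 4 1).sub r (entriesIn_plaqWord r x μ p.1 p.2)
    exact (h4.add r (h4.conjTranspose r)).mono r hn
  have hW₂ : ∀ p : Fin d × Bool, EntriesIn r (Set.univ : Set (Edge d L)) n (fun U : GaugeConfig d L G =>
      (r.ρ (wordHolonomy U x (plaqWord μ p.1 p.2)) - (r.ρ (wordHolonomy U x (plaqWord μ p.1 p.2)))ᴴ) -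
        (((2 * ((d : ℝ) - 1))⁻¹ : ℝ) : ℂ) • (plaqSum r.ρ x μ U - (plaqSum r.ρ x μ U)ᴴ)) := by
    intro p
    have hB : EntriesIn r (Set.univ : Set (Edge d L)) 4 (fun U : GaugeConfig d L G =>
        r.ρ (wordHolonomy U x (plaqWord μ p.1 p.2)) - (r.ρ (wordHolonomy U x (plaqWord μ p.1 p.2)))ᴴ) :=
      (entriesIn_plaqWord r x μ p.1 p.2).sub r ((entriesIn_plaqWord r x μ p.1 p.2).conjTranspose r)
    have hAe : EntriesIn r (Set.univ : Set (Edge d L)) 4 (fun U : GaugeConfig d L G =>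
        plaqSum r.ρ x μ U - (plaqSum r.ρ x μ U)ᴴ) :=
      (entriesIn_plaqSum r x μ).sub r ((entriesIn_plaqSum r x μ).conjTranspose r)
    exact (hB.sub r (hAe.smul_real r _)).mono r hn
  have hcost : ∀ p : Fin d × Bool, Continuous fun U : GaugeConfig d L G =>
      (r.N : ℝ) - (r.ρ (wordHolonomy U x (plaqWord μ p.1 p.2))).trace.re := fun p => continuous_const.sub (hcRe p.1 p.2)
  have hnW₁ : ∀ p : Fin d × Bool, Continuous fun U : GaugeConfig d L G =>
      ‖((1 : Matrix (Fin r.N) (Fin r.N) ℂ) - r.ρ (wordHolonomy U x (plaqWord μ p.1 p.2))) +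
        ((1 : Matrix (Fin r.N) (Fin r.N) ℂ) - r.ρ (wordHolonomy U x (plaqWord μ p.1 p.2)))ᴴ‖ ^ 2 := fun p =>
    (((continuous_const.sub (hcV p.1 p.2)).add ((continuous_const.sub (hcV p.1 p.2)).matrix_conjTranspose)).norm).pow 2
  -- (scalar multiples as diagonal products: `Continuous.const_smul` makes the elaborator compare the Frobenius and
  -- product topologies and times out)
  have hsm : Continuous fun U : GaugeConfig d L G =>
      (((2 * ((d : ℝ) - 1))⁻¹ : ℝ) : ℂ) • (plaqSum r.ρ x μ U - (plaqSum r.ρ x μ U)ᴴ) := by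
    have h := (continuous_const (y := Matrix.diagonal fun _ : Fin r.N => ((((2 * ((d : ℝ) - 1))⁻¹ : ℝ) : ℂ)))).mul
      (hM.sub hM.matrix_conjTranspose)
    simp only [Matrix.smul_eq_diagonal_mul]
    exact h
  have hnW₂ : ∀ p : Fin d × Bool, Continuous fun U : GaugeConfig d L G =>
      ‖(r.ρ (wordHolonomy U x (plaqWord μ p.1 p.2)) - (r.ρ (wordHolonomy U x (plaqWord μ p.1 p.2)))ᴴ) -
        (((2 * ((d : ℝ) - 1))⁻¹ : ℝ) : ℂ) • (plaqSum r.ρ x μ U - (plaqSum r.ρ x μ U)ᴴ)‖ ^ 2 := fun p =>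
    ((((hcV p.1 p.2).sub (hcV p.1 p.2).matrix_conjTranspose).sub hsm).norm).pow 2
  have hA' : Continuous fun U : GaugeConfig d L G => ‖plaqSum r.ρ x μ U - (plaqSum r.ρ x μ U)ᴴ‖ ^ 2 :=
    ((hM.sub hM.matrix_conjTranspose).norm).pow 2
  have hC : Continuous fun U : GaugeConfig d L G => ∑ p ∈ (Finset.univ.erase μ) ×ˢ (Finset.univ : Finset Bool),
      ((r.N : ℝ) - (r.ρ (wordHolonomy U x (plaqWord μ p.1 p.2))).trace.re) :=
    continuous_finsetSum _ fun p _ => hcost p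
  have hC' : Continuous fun U : GaugeConfig d L G => 16 * ((d : ℝ) - 1) *
      ∑ p ∈ (Finset.univ.erase μ) ×ˢ (Finset.univ : Finset Bool),
        ((r.N : ℝ) - (r.ρ (wordHolonomy U x (plaqWord μ p.1 p.2))).trace.re) := continuous_const.mul hC
  -- `φ` of the left side of the SOS identity
  have hlhs : evalR φ (fun U => 16 * ((d : ℝ) - 1) * (∑ p ∈ (Finset.univ.erase μ) ×ˢ (Finset.univ : Finset Bool),
      ((r.N : ℝ) - (r.ρ (wordHolonomy U x (plaqWord μ p.1 p.2))).trace.re)) -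
      ‖plaqSum r.ρ x μ U - (plaqSum r.ρ x μ U)ᴴ‖ ^ 2) =
      16 * ((d : ℝ) - 1) * ∑ p ∈ (Finset.univ.erase μ) ×ˢ (Finset.univ : Finset Bool),
        evalR φ (fun U => (r.N : ℝ) - (r.ρ (wordHolonomy U x (plaqWord μ p.1 p.2))).trace.re) -
        evalR φ (fun U => ‖plaqSum r.ρ x μ U - star (plaqSum r.ρ x μ U)‖ ^ 2) := by
    rw [evalR_sub φ hC' hA', evalR_smul φ _ hC, evalR_sum φ _ _ hcost]
    simp only [Matrix.star_eq_conjTranspose]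
  -- `φ` of the right side is non-negative
  have hrhs : 0 ≤ evalR φ (fun U => 16 * ((d : ℝ) - 1) * (∑ p ∈ (Finset.univ.erase μ) ×ˢ (Finset.univ : Finset Bool),
      ((r.N : ℝ) - (r.ρ (wordHolonomy U x (plaqWord μ p.1 p.2))).trace.re)) -
      ‖plaqSum r.ρ x μ U - (plaqSum r.ρ x μ U)ᴴ‖ ^ 2) := by
    rw [show (fun U => 16 * ((d : ℝ) - 1) * (∑ p ∈ (Finset.univ.erase μ) ×ˢ (Finset.univ : Finset Bool),
        ((r.N : ℝ) - (r.ρ (wordHolonomy U x (plaqWord μ p.1 p.2))).trace.re)) -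
        ‖plaqSum r.ρ x μ U - (plaqSum r.ρ x μ U)ᴴ‖ ^ 2) = fun U =>
        2 * ((d : ℝ) - 1) * (∑ p ∈ (Finset.univ.erase μ) ×ˢ (Finset.univ : Finset Bool),
          ‖((1 : Matrix (Fin r.N) (Fin r.N) ℂ) - r.ρ (wordHolonomy U x (plaqWord μ p.1 p.2))) +
            ((1 : Matrix (Fin r.N) (Fin r.N) ℂ) - r.ρ (wordHolonomy U x (plaqWord μ p.1 p.2)))ᴴ‖ ^ 2) +
        2 * ((d : ℝ) - 1) * (∑ p ∈ (Finset.univ.erase μ) ×ˢ (Finset.univ : Finset Bool),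
          ‖(r.ρ (wordHolonomy U x (plaqWord μ p.1 p.2)) - (r.ρ (wordHolonomy U x (plaqWord μ p.1 p.2)))ᴴ) -
            (((2 * ((d : ℝ) - 1))⁻¹ : ℝ) : ℂ) • (plaqSum r.ρ x μ U - (plaqSum r.ρ x μ U)ᴴ)‖ ^ 2)
        from funext fun U => sos_identity r.mem_unitary hd x μ U]
    have hs1 : Continuous fun U : GaugeConfig d L G => ∑ p ∈ (Finset.univ.erase μ) ×ˢ (Finset.univ : Finset Bool),
        ‖((1 : Matrix (Fin r.N) (Fin r.N) ℂ) - r.ρ (wordHolonomy U x (plaqWord μ p.1 p.2))) +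
          ((1 : Matrix (Fin r.N) (Fin r.N) ℂ) - r.ρ (wordHolonomy U x (plaqWord μ p.1 p.2)))ᴴ‖ ^ 2 :=
      continuous_finsetSum _ fun p _ => hnW₁ p
    have hs2 : Continuous fun U : GaugeConfig d L G => ∑ p ∈ (Finset.univ.erase μ) ×ˢ (Finset.univ : Finset Bool),
        ‖(r.ρ (wordHolonomy U x (plaqWord μ p.1 p.2)) - (r.ρ (wordHolonomy U x (plaqWord μ p.1 p.2)))ᴴ) -
          (((2 * ((d : ℝ) - 1))⁻¹ : ℝ) : ℂ) • (plaqSum r.ρ x μ U - (plaqSum r.ρ x μ U)ᴴ)‖ ^ 2 :=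
      continuous_finsetSum _ fun p _ => hnW₂ p
    have h2s1 : Continuous fun U : GaugeConfig d L G => 2 * ((d : ℝ) - 1) *
        ∑ p ∈ (Finset.univ.erase μ) ×ˢ (Finset.univ : Finset Bool),
          ‖((1 : Matrix (Fin r.N) (Fin r.N) ℂ) - r.ρ (wordHolonomy U x (plaqWord μ p.1 p.2))) +
            ((1 : Matrix (Fin r.N) (Fin r.N) ℂ) - r.ρ (wordHolonomy U x (plaqWord μ p.1 p.2)))ᴴ‖ ^ 2 :=
      continuous_const.mul hs1
    have h2s2 : Continuous fun U : GaugeConfig d L G => 2 * ((d : ℝ) - 1) *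
        ∑ p ∈ (Finset.univ.erase μ) ×ˢ (Finset.univ : Finset Bool),
          ‖(r.ρ (wordHolonomy U x (plaqWord μ p.1 p.2)) - (r.ρ (wordHolonomy U x (plaqWord μ p.1 p.2)))ᴴ) -
            (((2 * ((d : ℝ) - 1))⁻¹ : ℝ) : ℂ) • (plaqSum r.ρ x μ U - (plaqSum r.ρ x μ U)ᴴ)‖ ^ 2 :=
      continuous_const.mul hs2
    rw [evalR_add φ h2s1 h2s2, evalR_smul φ _ hs1, evalR_smul φ _ hs2, evalR_sum φ _ _ hnW₁, evalR_sum φ _ _ hnW₂]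
    have hd0 : (0 : ℝ) ≤ 2 * ((d : ℝ) - 1) := by
      have : (2 : ℝ) ≤ d := by exact_mod_cast hd
      linarith
    exact add_nonneg (mul_nonneg hd0 (Finset.sum_nonneg fun p _ => evalR_norm_sq_nonneg r φ hpos (hW₁ p)))
      (mul_nonneg hd0 (Finset.sum_nonneg fun p _ => evalR_norm_sq_nonneg r φ hpos (hW₂ p)))
  rw [hlhs] at hrhs
  linarith

end Rows

/-! ## The bound for a functional -/

/-- ★★★ **THE EQUIPARTITION BOUND FOR A FUNCTIONAL.**  Let `φ` be a linear functional on `C(GaugeConfig, ℝ)` with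
`φ 1 = 1`, `0 ≤ φ(v²)` for every level-`n` test function (`n ≥ 4`), and the pair rows for the `2(d−1)` plaquette
words through `(x, μ)` at a real weight `0 ≤ s < N²` (`d ≥ 2`, `L ≥ 2`, `β ≥ 0`).  Then, with `c = N − s/N`,
`Σ_{ν≠μ, ε} φ((1/N)·Re tr ρ(hol P̃_{ν,ε})) ≤ 2(d−1)·(1 − c/(4(d−1)β + c))`. [folklore] -/
theorem sum_evalR_plaquette_le_of_sdPairF [NeZero L] (hL : (1 : ZMod L) ≠ 0) (hd : 2 ≤ d) {β : ℝ} (hβ : 0 ≤ β)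
    (x : Site d L) (μ : Fin d) {s : ℝ} (hs0 : 0 ≤ s) (hsN : s < (r.N : ℝ) ^ 2) {n : ℕ} (hn : 4 ≤ n)
    (h1 : φ 1 = 1) (hpos : ∀ v ∈ wordTruncation (ι := Edge d L) r n, 0 ≤ φ (v * v))
    (hP : ∀ ν ∈ Finset.univ.erase μ, ∀ (ε : Bool) (i j : Fin r.N),
      SDPairF r φ β x μ x (plaqWord μ ν ε) (unitDir (s : ℂ) i j)) :
    (∑ ν ∈ Finset.univ.erase μ, ∑ ε : Bool,
        evalR φ (fun U => (r.N : ℝ)⁻¹ * (r.ρ (wordHolonomy U x (plaqWord μ ν ε))).trace.re)) ≤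
      2 * ((d : ℝ) - 1) * (1 - ((r.N : ℝ) - s / r.N) / (4 * ((d : ℝ) - 1) * β + ((r.N : ℝ) - s / r.N))) := by
  have hN0 : r.N ≠ 0 := by
    rintro h; rw [h] at hsN; simp at hsN; linarith
  have hNpos : (0 : ℝ) < r.N := by exact_mod_cast Nat.pos_of_ne_zero hN0
  have hcpos : 0 < (r.N : ℝ) - s / r.N := by rw [sub_pos, div_lt_iff₀ hNpos, ← sq]; exact hsN
  have hd1 : (1 : ℝ) ≤ (d : ℝ) - 1 := by
    have : (2 : ℝ) ≤ d := by exact_mod_cast hd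
    linarith
  have hcRe : ∀ ν ε, Continuous fun U : GaugeConfig d L G => (r.ρ (wordHolonomy U x (plaqWord μ ν ε))).trace.re :=
    fun ν ε => Complex.continuous_re.comp (r.continuous.comp (continuous_wordHolonomy x _)).matrix_trace
  have hid := rows_re_identity r φ hL β x μ s hP
  have hT := evalR_imTrace_plaqSum_sq_nonneg r φ x μ hn hpos
  have hAle := evalR_norm_sq_A_le r φ hd x μ hn hpos
  -- the total cost in terms of `R = Σ φ(Re tr V)`
  have hC : ∑ p ∈ (Finset.univ.erase μ) ×ˢ (Finset.univ : Finset Bool),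
      evalR φ (fun U => (r.N : ℝ) - (r.ρ (wordHolonomy U x (plaqWord μ p.1 p.2))).trace.re) =
      2 * ((d : ℝ) - 1) * r.N - ∑ ν ∈ Finset.univ.erase μ, ∑ ε : Bool,
        evalR φ (fun U => (r.ρ (wordHolonomy U x (plaqWord μ ν ε))).trace.re) := by
    have h : ∀ p : Fin d × Bool, evalR φ (fun U => (r.N : ℝ) - (r.ρ (wordHolonomy U x (plaqWord μ p.1 p.2))).trace.re) =
        r.N - evalR φ (fun U => (r.ρ (wordHolonomy U x (plaqWord μ p.1 p.2))).trace.re) := fun p => by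
      rw [evalR_sub φ continuous_const (hcRe p.1 p.2), evalR_const φ h1]
    rw [Finset.sum_congr rfl fun p _ => h p, Finset.sum_sub_distrib, Finset.sum_const, nsmul_eq_mul, card_plaqIndex μ,
      Finset.sum_product]
  rw [hC] at hAle
  -- abbreviate the three `φ`-values
  set R : ℝ := ∑ ν ∈ Finset.univ.erase μ, ∑ ε : Bool,
    evalR φ (fun U => (r.ρ (wordHolonomy U x (plaqWord μ ν ε))).trace.re) with hR
  set EA : ℝ := evalR φ (fun U => ‖plaqSum r.ρ x μ U - star (plaqSum r.ρ x μ U)‖ ^ 2) with hEA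
  set ET : ℝ := evalR φ (fun U => ((plaqSum r.ρ x μ U).trace.im) ^ 2) with hET
  set c : ℝ := (r.N : ℝ) - s / r.N with hc
  have hβEA : β / 4 * EA ≤ β / 4 * (16 * ((d : ℝ) - 1) * (2 * ((d : ℝ) - 1) * r.N - R)) :=
    mul_le_mul_of_nonneg_left hAle (by positivity)
  have hβET : 0 ≤ β * s / r.N * ET := by positivity
  have h1' : c * R = β / 4 * EA - β * s / r.N * ET := by
    have h0 : c * R + β / 2 * (-(1 / 2) * EA + 2 * s / r.N * ET) = 0 := hid
    have h2 : β * s / r.N * ET = β / 2 * (2 * s / r.N * ET) := by ring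
    rw [h2]
    linarith
  have hineq : c * R ≤ 4 * ((d : ℝ) - 1) * β * (2 * ((d : ℝ) - 1) * r.N - R) := by nlinarith [h1', hβEA, hβET]
  have hK : (0 : ℝ) < 4 * ((d : ℝ) - 1) * β + c := by positivity
  have hRle : R ≤ (r.N : ℝ) * (2 * ((d : ℝ) - 1) * (1 - c / (4 * ((d : ℝ) - 1) * β + c))) := by
    rw [show 1 - c / (4 * ((d : ℝ) - 1) * β + c) = 4 * ((d : ℝ) - 1) * β / (4 * ((d : ℝ) - 1) * β + c) by
      field_simp; ring]
    rw [show (r.N : ℝ) * (2 * ((d : ℝ) - 1) * (4 * ((d : ℝ) - 1) * β / (4 * ((d : ℝ) - 1) * β + c))) =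
      (r.N : ℝ) * 2 * ((d : ℝ) - 1) * (4 * ((d : ℝ) - 1) * β) / (4 * ((d : ℝ) - 1) * β + c) by ring,
      le_div_iff₀ hK]
    nlinarith [hineq]
  have hnorm : (∑ ν ∈ Finset.univ.erase μ, ∑ ε : Bool,
      evalR φ (fun U => (r.N : ℝ)⁻¹ * (r.ρ (wordHolonomy U x (plaqWord μ ν ε))).trace.re)) = (r.N : ℝ)⁻¹ * R := by
    rw [hR, Finset.mul_sum]
    refine Finset.sum_congr rfl fun ν _ => ?_
    rw [Finset.mul_sum]
    exact Finset.sum_congr rfl fun ε _ => evalR_smul φ _ (hcRe ν ε)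
  rw [hnorm, inv_mul_le_iff₀ hNpos]
  exact hRle

end Equipartition

end Summit.QuantumFields.GaugeBoot

end
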